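import Literature.InformationTheory.QuantumCodes.HypergraphProduct
import Literature.InformationTheory.QuantumCodes.SyndromeDecoding
import Literature.InformationTheory.QuantumCodes.ClusterCountingBound
import Literature.InformationTheory.QuantumCodes.MinWeightDecodingClusters
import Mathlib.Analysis.SpecialFunctions.BinaryEntropy
import Mathlib.Analysis.SpecialFunctions.Pow.Real
import HarnessLib

/-!
# Quantum expander codes and the small-set-flip decoder: adversarial radius (Leverrier–Tillich–Zémor
# 2015) and the random-error threshold (Fawzi–Grospellier–Leverrier 2018) — STATEMENTS

Topic `Literature/InformationTheory/QuantumCodes` (venture QEC, LADDER-QEC rung Q5 "then qLDPC +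
small-set-flip (expansion-based bounds as printed)"; director-qec g2 ruling R9 (4), 2026-08-26T23:55Z:
"STATEMENTS ONLY … expander/SSF definitions + the Leverrier–Tillich–Zémor / Fawzi–Grospellier–Leverrier
threshold statements as named facts with hypotheses, locators read on the page; no proofs, no
numerics"). Column words: DEFINITION (bipartite expansion of a Tanner graph; the quantum expander code
`Q_G` as the tree's hypergraph product; the small-set-flip decoder as a NONDETERMINISTIC procedure —
valid steps, halting, complete runs, "`D` is a small-set-flip decoder"; `α`-subsets), PROVED (only
`expanderHX_mul_expanderHZ_transpose`, the CSS condition, by import from type-04's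
`HypergraphProduct.xMatrix_mul_zMatrix_transpose`), and STATEMENT-ONLY named facts `def … : Prop`
(D-0014): `LTZ15_theorem2` (adversarial radius `w₀`), `FGL18_proposition11` (adversarial radius of
the `β`-version), `FGL18_theorem1` (the THRESHOLD under local stochastic noise),
`FGL18_theorem17` (`α`-percolation, generic graph theory). No numerical threshold is asserted; the
printed illustration `p_ls = 2.70·10⁻¹⁶` (FGL18 App. A, for `d_A = 38`, `d_B = 39`) is a number
about THEIR bound, recorded here only in this sentence.

**Objects and dictionary.** A bipartite graph `G = (A ∪ B, ℰ)` is given by its biadjacency matrix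
`H : Matrix B A (ZMod 2)` ("the `n_B × n_A` matrix `H`, whose rows are indexed by the vertices of `B`,
whose columns are indexed by the vertices of `A`, and such that `H_{ij} = 1` if `i` and `j` are
adjacent", LTZ15 §2) — the parity-check matrix of the classical code `𝒞_G = ker H`. Expansion (LTZ15
§2; FGL18 Def. 2): `G` is `(γ_A, δ_A)`-left-expanding if `|Γ(S)| ≥ (1-δ_A) Δ_A |S|` for every
`S ⊆ A` with `|S| ≤ γ_A n_A`; right-expanding symmetrically; biregular with degrees `Δ_A` (columns)
and `Δ_B` (rows). The quantum expander code `Q_G` (LTZ15 §2; FGL18 §2.3) is the Tillich–Zémor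
hypergraph product of `G` with itself: qubits `A² ∪ B²`, `σ_X`-checks indexed by `A × B`, generators
`g_{ba}` (rows of LTZ15's `H_Z`) indexed by `B × A`. In the tree's `HypergraphProduct` vocabulary
(type-04: `Hᵢ : Matrix Vᵢ Eᵢ`, qubits `(E₁ × V₂) ⊕ (V₁ × E₂)`) this is `ℋ₁ = (H : Matrix B A)`,
`ℋ₂ = ℋ₁ᵀ`, qubits `(A × A) ⊕ (B × B)`, and — CHECK THE INCIDENCES, done in the docstrings of
`expanderHX` / `expanderHZ` — LTZ15's `H_X` (rows `A × B`) is the tree's CHAMBER matrix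
`HypergraphProduct.zMatrix H Hᵀ` while LTZ15's `H_Z` (rows `B × A`) is the tree's VERTEX matrix
`HypergraphProduct.xMatrix H Hᵀ` (the letters `X/Z` are opposite in the two sources; nothing below
depends on the letters, only on which matrix measures the error and which one spans the harmless
corrections). Everything is typed for ONE error type ("The decoding algorithm treats `X` and `Z` errors
independently … We will therefore describe the decoding algorithm for errors of type `(e_X, 0)`, the
other case being symmetric", LTZ15 §3): errors `e : Q → ZMod 2` are measured by `Hs *ᵥ e`
(`Hs = expanderHX H`) and corrected modulo `rowSpace Hg` (`Hg = expanderHZ H`; FGL18: "SUCCESS: if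
`E ⊕ Ê = ⊕_{x ∈ X} x` for `X ⊆ 𝒳`") — exactly the tree's `Decoder.Corrects (Hs *ᵥ ·) (rowSpace Hg)`
(`SyndromeDecoding.lean`). The `Z`-sector statements are the same statements for the reversed graph
`Hᵀ` (roles of `A` and `B` exchanged) and are not asserted separately.

**The small-set-flip decoder** (LTZ15 §3; FGL18 Algorithms 1–2): with `𝓕 = {F ⊆ g : g a generator}`
the nonempty "small sets", from the syndrome `σ₀ = σ` repeat: if some `F ∈ 𝓕` has
`|σᵢ| - |σᵢ ⊕ σ_X(F)| ≥ β d_B |F|` (Algorithm 2; Algorithm 1: `> 0`), flip an `F` MAXIMISING the ratio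
`(|σᵢ| - |σᵢ ⊕ σ_X(F)|)/|F|` ("pick an arbitrary one if there are several choices"), else stop and
output `Ê = F₀ ⊕ ⋯ ⊕ F_{f-1}`. Typed as a nondeterministic procedure with a per-qubit decrease
threshold `κ` (`κ = 0`: Algorithm 1 = LTZ15's decoder; `κ = β Δ_B`: Algorithm 2): `IsSSFStep`,
`SSFHalts`, `IsSSFRun` (complete valid runs), `runOutput`, and `IsSSFDecoder κ Hs Hg D` — the tree
`Decoder` `D` returns, on every syndrome, the output of SOME complete valid run (any tie-breaking).
The printed guarantees hold "for any non-deterministic choice of the `Fᵢ`" (FGL18 after Prop. 11),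
i.e. for EVERY small-set-flip decoder in this sense.

**Typed facts** (all `def … : Prop`, STATEMENT ONLY; quantifier order as printed, constants uniform in
the code size):
* `LTZ15_theorem2` — biregular `(γ_A, δ_A, γ_B, δ_B)`-expanding `G` with `δ_A, δ_B < 1/6`: every
  small-set-flip decoder (`κ = 0`) corrects every error of weight `< w₀ = min(γ_A n_A, γ_B n_B)/(3(1+Δ_B))`
  (LTZ15 Thm 2 = FGL18 Thm 6; the clause "runs in time linear in `n`" is NOT typed — no cost model —
  and the phrase "letting `Δ_A, Δ_B` be fixed and allowing `n_A, n_B` to grow" is read as pertaining to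
  it: the correction claim is typed per instance, `-- TODO(general form)` below).
* `FGL18_proposition11` — the `β`-version: with `r = Δ_A/Δ_B`,
  `β₀ = (r/2)(1 - 4(δ_A + δ_B + (δ_B - δ_A)²))`, every small-set-flip decoder of parameter
  `κ = β₀ Δ_B` corrects every error of weight `≤ (r β₀/(1+β₀)) min(γ_A n_A, γ_B n_B)`.
* `FGL18_theorem1` — THE THRESHOLD: for fixed degrees and expansion parameters with `β₀ > 0`
  ("sufficient expansion") there are `p₀ > 0` and constants `C, C'` such that for every quantum
  expander code with these parameters, every small-set-flip decoder (Algorithm 1) and every locally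
  stochastic error law of parameter `p < p₀` (the tree's `IsLocallyStochastic`, `ClusterCountingBound.lean`
  — FGL18 Def. 8; the independent model Def. 7 is the special case `bernoulliWeight`), the total weight
  of the errors NOT corrected is `≤ C n (p/p₀)^{C'√n}`, `n = n_A² + n_B²`.
* `FGL18_theorem17` — `α`-percolation on any graph of maximum degree `d ≥ 3`: for local stochastic
  `E` with `p < p_ls = (2^{-h(α)}/((d-1)(1+1/(d-2))^{d-2}))^{1/α}`,
  `P[MaxConn_α(E) ≥ t] ≤ C|V|(p/p_ls)^{αt}`, `1/C = (1 - 2^{h(α)/α} p)(1 - (p/p_ls)^α)`; typed with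
  `2^{-h(α)} = exp(-binEntropy α)` (Mathlib's natural-log binary entropy) and the event
  `HasAlphaCluster G α t E` ("some connected `α`-subset of `E` of size `≥ t`"; `α = 1/2` is the tree's
  `HasDenseCluster`).

Deliberately NOT here: proofs (Q5 wave; the director's word opens them); running-time claims; the
existence of expanders (FGL18 Thm 4 / LTZ15 [Bas81, SS96]) and Sipser–Spielman's classical theorem
(LTZ15 Thm 1); the fault-tolerance application (Gottesman 2014, FGL18 FOCS companion); numerics.

## References (read)

* [LeverrierTillichZemor2015] A. Leverrier, J.-P. Tillich, G. Zémor, *Quantum expander codes*, FOCS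
  2015, 810–824, arXiv:1504.00822 (held `paper:arxiv-1504.00822`): §2 (expansion, `H`, `𝒢_X`/`𝒢_Z`,
  Thm 2 with eq. (w0); p0005–p0006), §3 (the decoder; p0007), §4 Prop. 4 / Cor. 5 (distance).
* [FawziGrospellierLeverrier2018] O. Fawzi, A. Grospellier, A. Leverrier, *Efficient decoding of random
  errors for quantum expander codes*, STOC 2018, 521–534, arXiv:1711.08351 (held
  `paper:arxiv-1711.08351`): Thm 1 (§1, p0004), Def. 2 / Thm 5 / Algorithm 1 / Thm 6 (§2, p0006–p0009),
  Def. 7–8 / Algorithm 2 / Remark 9 / Def. 10 / Prop. 11 (§3, p0010–p0011), Def. 13 / Lemma 14 /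
  Prop. 15 (p0012), Thm 17 and the proof of Thm 1 (§4, p0013–p0014).
-/

namespace Literature.InformationTheory.QuantumCodes

open Finset Matrix
open Literature.Probability.LatticeModels

/-! ### Bipartite (Tanner-graph) expansion of a biadjacency / parity-check matrix -/

section Expansion

variable {A B : Type*} [Fintype A] [Fintype B] [DecidableEq A] [DecidableEq B]

/-- The neighbourhood `Γ(S) ⊆ B` of a set `S ⊆ A` of left vertices (bits / columns) in the bipartite
graph with biadjacency matrix `H` (`b ∈ Γ(S)` iff `H_{b a} ≠ 0` for some `a ∈ S`).
[cite: LeverrierTillichZemor2015, §2 (Γ(S); arXiv v1 p0005)] -/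
def leftNbhd (H : Matrix B A (ZMod 2)) (S : Finset A) : Finset B :=
  univ.filter fun b => ∃ a ∈ S, H b a ≠ 0

/-- The neighbourhood `Γ(T) ⊆ A` of a set `T ⊆ B` of right vertices (checks / rows).
[cite: LeverrierTillichZemor2015, §2 (Γ(S); arXiv v1 p0005)] -/
def rightNbhd (H : Matrix B A (ZMod 2)) (T : Finset B) : Finset A :=
  univ.filter fun a => ∃ b ∈ T, H b a ≠ 0

/-- `G` is **`(Δ_A, Δ_B)`-biregular**: every left vertex (column) has exactly `Δ_A` neighbours and every
right vertex (row) exactly `Δ_B` ("biregular bipartite graph with left (resp. right) degree equal to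
`Δ_A` (resp. `Δ_B`)"). [cite: LeverrierTillichZemor2015, §2 (arXiv v1 p0005)] -/
def IsBiregular (H : Matrix B A (ZMod 2)) (dA dB : ℕ) : Prop :=
  (∀ a : A, (univ.filter fun b : B => H b a ≠ 0).card = dA) ∧
    ∀ b : B, (univ.filter fun a : A => H b a ≠ 0).card = dB

/-- `G` is **`(γ_A, δ_A)`-left-expanding** (for left degree `Δ_A`): "for any subset `S ⊆ A` with
`|S| ≤ γ_A n_A` we have `|Γ(S)| ≥ (1-δ_A) Δ_A |S|`".
[cite: LeverrierTillichZemor2015, §2 (arXiv v1 p0005)] [cite: FawziGrospellierLeverrier2018, Def 2] -/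
def IsLeftExpanding (H : Matrix B A (ZMod 2)) (dA : ℕ) (γ δ : ℝ) : Prop :=
  ∀ S : Finset A, (S.card : ℝ) ≤ γ * Fintype.card A →
    (1 - δ) * dA * S.card ≤ ((leftNbhd H S).card : ℝ)

/-- `G` is **`(γ_B, δ_B)`-right-expanding** (for right degree `Δ_B`): "for any subset `S ⊆ B` with
`|S| ≤ γ_B n_B` we have `|Γ(S)| ≥ (1-δ_B) Δ_B |S|`".
[cite: LeverrierTillichZemor2015, §2 (arXiv v1 p0005)] [cite: FawziGrospellierLeverrier2018, Def 2] -/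
def IsRightExpanding (H : Matrix B A (ZMod 2)) (dB : ℕ) (γ δ : ℝ) : Prop :=
  ∀ T : Finset B, (T.card : ℝ) ≤ γ * Fintype.card B →
    (1 - δ) * dB * T.card ≤ ((rightNbhd H T).card : ℝ)

/-- `G` is **`(γ_A, δ_A, γ_B, δ_B)`-left-right-expanding** ("or simply expanding"): both left- and
right-expanding. [cite: LeverrierTillichZemor2015, §2 (arXiv v1 p0005)] [cite: FawziGrospellierLeverrier2018, Def 2] -/
def IsLeftRightExpanding (H : Matrix B A (ZMod 2)) (dA dB : ℕ) (γA δA γB δB : ℝ) : Prop :=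
  IsLeftExpanding H dA γA δA ∧ IsRightExpanding H dB γB δB

end Expansion

/-! ### The quantum expander code `Q_G` = hypergraph product of `G` with itself -/

section ExpanderCode

variable {A B : Type*} [Fintype A] [Fintype B] [DecidableEq A] [DecidableEq B]

/-- LTZ15's **`H_X`** of `Q_G` — the factor graph `𝒢_X`: qubits `A² ∪ B²` (here `(A × A) ⊕ (B × B)`),
checks `αβ ∈ A × B`, "`Γ(αa) = {αβ : a ∼ β}`" and "`Γ(bβ) = {αβ : α ∼ b}`". In the tree's
hypergraph-product vocabulary (`ℋ₁ = H : Matrix B A`, `ℋ₂ = ℋ₁ᵀ`) this is the CHAMBER matrix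
`HypergraphProduct.zMatrix H Hᵀ` (entry formulas `zMatrix_apply_inl`: `[α = α']·Hᵀ a β`, and
`zMatrix_apply_inr`: `H b α·[β = β']` — exactly the two printed incidences). The letters `X/Z` of
type-04's file and of LTZ15 are opposite; see the module docstring.
[cite: LeverrierTillichZemor2015, §2 (𝒢_X; arXiv v1 p0005)] [cite: FawziGrospellierLeverrier2018, §2.3 (H_X = (I ⊗ H, Hᵀ ⊗ I))] -/
def expanderHX (H : Matrix B A (ZMod 2)) : Matrix (A × B) ((A × A) ⊕ (B × B)) (ZMod 2) :=
  HypergraphProduct.zMatrix H Hᵀ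

/-- LTZ15's **`H_Z`** of `Q_G` — the factor graph `𝒢_Z` with checks `ba ∈ B × A`; its rows are the
"generators" `g_{ba} = {αa : α ∼ b} ∪ {bβ : β ∼ a}` inside which the small-set-flip decoder for
`X`-errors flips. In the tree's vocabulary: the VERTEX matrix `HypergraphProduct.xMatrix H Hᵀ`
(`xMatrix_apply_inl`: `H b α·[a = a']`; `xMatrix_apply_inr`: `[b = b']·Hᵀ a β`).
[cite: LeverrierTillichZemor2015, §3 eq. (g_ba) (arXiv v1 p0007)] [cite: FawziGrospellierLeverrier2018, §2.3 (H_Z = (H ⊗ I, I ⊗ Hᵀ))] -/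
def expanderHZ (H : Matrix B A (ZMod 2)) : Matrix (B × A) ((A × A) ⊕ (B × B)) (ZMod 2) :=
  HypergraphProduct.xMatrix H Hᵀ

/-- The CSS condition `H_X H_Zᵀ = 0` for `Q_G` ("`H_X H_Zᵀ = Hᵀ ⊗ H + Hᵀ ⊗ H = 0`"), by transposing
the tree's `HypergraphProduct.xMatrix_mul_zMatrix_transpose`. PROVED.
[cite: FawziGrospellierLeverrier2018, §2.3 (H_X H_Z^T = 0)] -/
theorem expanderHX_mul_expanderHZ_transpose (H : Matrix B A (ZMod 2)) :
    expanderHX H * (expanderHZ H)ᵀ = 0 := by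
  have h := HypergraphProduct.xMatrix_mul_zMatrix_transpose H Hᵀ
  have ht := congrArg Matrix.transpose h
  rw [Matrix.transpose_mul, Matrix.transpose_transpose, Matrix.transpose_zero] at ht
  exact ht

end ExpanderCode

/-! ### The small-set-flip decoder as a nondeterministic procedure (one error type) -/

section SmallSetFlip

variable {Q C R : Type*} [Fintype Q] [Fintype C] [Fintype R] [DecidableEq Q] [DecidableEq C]

/-- The indicator vector `𝟙_F ∈ 𝔽₂^Q` of a set of qubits ("the binary word `e` is described by a
subset `E ⊆ V` whose indicator vector is `e`"). [cite: FawziGrospellierLeverrier2018, §2.1] -/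
def flipVec (F : Finset Q) : Q → ZMod 2 :=
  fun q => if q ∈ F then 1 else 0

/-- The support of a generator: the qubits on which the row `g` of the generator matrix `Hg` acts
(LTZ15: "we choose to identify the corresponding generator with its support … `g_{ba}`").
[cite: LeverrierTillichZemor2015, §3 eq. (g_ba) (arXiv v1 p0007)] -/
def genSupport (Hg : Matrix R Q (ZMod 2)) (g : R) : Finset Q :=
  univ.filter fun q => Hg g q ≠ 0

/-- The **small sets** `𝓕 = {F ⊆ x : x ∈ 𝒳}` (nonempty subsets of generator supports) — the
candidate flips of the small-set-flip decoder. [cite: FawziGrospellierLeverrier2018, §2.3 (𝓕 := {F ⊆ x : x ∈ 𝒳})] -/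
def smallSets (Hg : Matrix R Q (ZMod 2)) : Finset (Finset Q) :=
  (univ.biUnion fun g => (genSupport Hg g).powerset).erase ∅

/-- The syndrome-weight DECREASE `|σ| - |σ ⊕ σ_X(F)|` achieved by flipping `F` at syndrome `σ`
(an integer, possibly negative). [cite: FawziGrospellierLeverrier2018, Algorithm 1 (|σᵢ| - |σᵢ ⊕ σ_X(F)|)] -/
def syndromeDecrease (Hs : Matrix C Q (ZMod 2)) (σ : C → ZMod 2) (F : Finset Q) : ℤ :=
  (hammingNorm σ : ℤ) - hammingNorm (σ + Hs *ᵥ flipVec F)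

/-- A **valid step** of the small-set-flip decoder with per-qubit threshold `κ` at syndrome `σ`:
flip a small set `F` whose decrease is positive and at least `κ |F|` (the while-condition:
Algorithm 1 `> 0`, i.e. `κ = 0`; Algorithm 2 `≥ β d_B |F|`, i.e. `κ = β Δ_B`) and which MAXIMISES the
ratio decrease/`|F|` over all small sets ("`Fᵢ = argmax_{F ∈ 𝓕} (|σᵢ| - |σᵢ ⊕ σ_X(F)|)/|F|` — pick an
arbitrary one if there are several choices"). [cite: FawziGrospellierLeverrier2018, Algorithms 1–2 (§2.3, §3.2)]
[cite: LeverrierTillichZemor2015, §3 (the three conditions on e₁; arXiv v1 p0007)] -/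
def IsSSFStep (κ : ℝ) (Hs : Matrix C Q (ZMod 2)) (Hg : Matrix R Q (ZMod 2)) (σ : C → ZMod 2)
    (F : Finset Q) : Prop :=
  F ∈ smallSets Hg ∧ 0 < syndromeDecrease Hs σ F ∧ κ * F.card ≤ (syndromeDecrease Hs σ F : ℝ) ∧
    ∀ F' ∈ smallSets Hg,
      (syndromeDecrease Hs σ F' : ℝ) / F'.card ≤ (syndromeDecrease Hs σ F : ℝ) / F.card

/-- The decoder **halts** at syndrome `σ`: no small set passes the while-condition (no `F ∈ 𝓕` with
positive decrease `≥ κ |F|`; LTZ15: "If the algorithm cannot find a vector `e₁` satisfying the first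
two conditions, it outputs …"). [cite: FawziGrospellierLeverrier2018, Algorithms 1–2 (while condition)] -/
def SSFHalts (κ : ℝ) (Hs : Matrix C Q (ZMod 2)) (Hg : Matrix R Q (ZMod 2)) (σ : C → ZMod 2) : Prop :=
  ∀ F ∈ smallSets Hg, ¬ (0 < syndromeDecrease Hs σ F ∧ κ * F.card ≤ (syndromeDecrease Hs σ F : ℝ))

/-- A **complete valid run** of the small-set-flip decoder from the syndrome `σ`: the list of flipped
small sets `F₀, …, F_{f-1}`, each a valid step at the current syndrome
`σᵢ₊₁ = σᵢ ⊕ σ_X(Fᵢ)`, ending in a halting syndrome.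
[cite: FawziGrospellierLeverrier2018, Algorithms 1–2 (§2.3, §3.2)] -/
inductive IsSSFRun (κ : ℝ) (Hs : Matrix C Q (ZMod 2)) (Hg : Matrix R Q (ZMod 2)) :
    (C → ZMod 2) → List (Finset Q) → Prop
  | halt {σ : C → ZMod 2} : SSFHalts κ Hs Hg σ → IsSSFRun κ Hs Hg σ []
  | step {σ : C → ZMod 2} {F : Finset Q} {l : List (Finset Q)} :
      IsSSFStep κ Hs Hg σ F → IsSSFRun κ Hs Hg (σ + Hs *ᵥ flipVec F) l → IsSSFRun κ Hs Hg σ (F :: l)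

/-- The output `Ê = F₀ ⊕ ⋯ ⊕ F_{f-1}` of a run (as a vector of `𝔽₂^Q`).
[cite: FawziGrospellierLeverrier2018, Algorithm 1 (Êᵢ₊₁ = Êᵢ ⊕ Fᵢ)] -/
def runOutput (l : List (Finset Q)) : Q → ZMod 2 :=
  (l.map flipVec).sum

/-- **`D` is a small-set-flip decoder** (threshold `κ`, syndrome matrix `Hs`, generator matrix `Hg`):
a tree `Decoder` that returns, on every syndrome, the output of SOME complete valid run — i.e. one
fixed resolution of the printed nondeterminism ("(algo) is not deterministic since the `Fᵢ` are not
necessarily unique but … the error is corrected for any non-deterministic choice of the `Fᵢ`").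
[cite: FawziGrospellierLeverrier2018, §3.2 (after Prop. 11)] -/
def IsSSFDecoder (κ : ℝ) (Hs : Matrix C Q (ZMod 2)) (Hg : Matrix R Q (ZMod 2))
    (D : Decoder (C → ZMod 2) (Q → ZMod 2)) : Prop :=
  ∀ σ : C → ZMod 2, ∃ l : List (Finset Q), IsSSFRun κ Hs Hg σ l ∧ D σ = runOutput l

end SmallSetFlip

/-! ### `α`-subsets and the `α`-percolation event -/

section Percolation

variable {V : Type*} [Fintype V] [DecidableEq V]

/-- `X` is an **`α`-subset** of `E`: `|X ∩ E| ≥ α |X|`. [cite: FawziGrospellierLeverrier2018, Def 13] -/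
def IsAlphaSubset (α : ℝ) (E X : Finset V) : Prop :=
  α * X.card ≤ ((X ∩ E).card : ℝ)

/-- The event **`MaxConn_α(E) ≥ t`**: some connected (in `G`, the tree's `IsGraphConnected`)
`α`-subset of `E` has at least `t` vertices (`MaxConn_α(E)` = the maximum size of a connected
`α`-subset). For `α = 1/2` and `t = d` this is the tree's `HasDenseCluster G d E`.
[cite: FawziGrospellierLeverrier2018, Def 13 (MaxConn_α(E))] -/
def HasAlphaCluster (G : SimpleGraph V) (α : ℝ) (t : ℕ) (E : Finset V) : Prop :=
  ∃ X : Finset V, IsGraphConnected G X ∧ t ≤ X.card ∧ IsAlphaSubset α E X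

/-- The local-stochastic percolation value `p_ls = (2^{-h(α)} / ((d-1)(1+1/(d-2))^{d-2}))^{1/α}`
of a degree bound `d ≥ 3` and `α ∈ (0,1]`, with `2^{-h(α)} = e^{-binEntropy α} = α^α (1-α)^{1-α}`
(Mathlib's natural-log binary entropy). [cite: FawziGrospellierLeverrier2018, Thm 17 eq. (pls)] -/
noncomputable def percolationValue (d : ℕ) (α : ℝ) : ℝ :=
  (Real.exp (-Real.binEntropy α) / (((d : ℝ) - 1) * (1 + 1 / ((d : ℝ) - 2)) ^ (d - 2))) ^ (1 / α)

end Percolation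

/-! ### The printed statements (STATEMENT ONLY — named facts, D-0014) -/

section Facts

/-- The parameter `β₀ = (r/2)[1 - 4(δ_A + δ_B + (δ_B - δ_A)²)]`, `r = Δ_A/Δ_B`, of the `β`-version of
the decoder ("`δ_A, δ_B < 1/8` is sufficient to ensure that `β₀ > 0`").
[cite: FawziGrospellierLeverrier2018, Def 10] -/
noncomputable def betaZero (dA dB : ℕ) (δA δB : ℝ) : ℝ :=
  ((dA : ℝ) / dB) / 2 * (1 - 4 * (δA + δB + (δB - δA) ^ 2))

/-- **Leverrier–Tillich–Zémor 2015, Theorem 2** (= FGL18 Thm 6), correction clause, `X`-sector: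
for a `(Δ_A, Δ_B)`-biregular `(γ_A, δ_A, γ_B, δ_B)`-left-right-expanding `G` with `δ_A, δ_B < 1/6`,
the small-set-flip decoder (Algorithm 1, `κ = 0`; any tie-breaking) "decodes any quantum error pattern
of weight less than `w₀ = (1/(3(1+Δ_B))) min(γ_A n_A, γ_B n_B)`" — typed for the errors `(e_X, 0)`
("it is enough to prove Theorem 2 for error patterns of the form `(e_X,0)` and of the form `(0,e_Z)`";
the `Z`-sector is the same statement for `Hᵀ`). NOT typed: "runs in time linear in the code length"
(no cost model). -- TODO(general form): the printed theorem carries the clause "Letting `Δ_A` and `Δ_B`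
be fixed and allowing `n_A, n_B` to grow", read here as qualifying the running-time claim; if the
correction claim itself needs `n_A` large, this per-instance typing is stronger than printed (flagged
for the refuter). STATEMENT ONLY.
[cite: LeverrierTillichZemor2015, Thm 2 eq. (w0) (arXiv v1 p0006) and §3 (p0007)] [cite: FawziGrospellierLeverrier2018, Thm 6] -/
def LTZ15_theorem2 : Prop :=
  ∀ (A B : Type) [Fintype A] [Fintype B] [DecidableEq A] [DecidableEq B]
    (H : Matrix B A (ZMod 2)) (dA dB : ℕ) (γA δA γB δB : ℝ),
    IsBiregular H dA dB → IsLeftRightExpanding H dA dB γA δA γB δB →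
    0 < γA → 0 < δA → δA < 1 / 6 → 0 < γB → 0 < δB → δB < 1 / 6 →
    ∀ D : Decoder (A × B → ZMod 2) ((A × A) ⊕ (B × B) → ZMod 2),
      IsSSFDecoder 0 (expanderHX H) (expanderHZ H) D →
      ∀ e : (A × A) ⊕ (B × B) → ZMod 2,
        (hammingNorm e : ℝ) <
            1 / (3 * (1 + (dB : ℝ))) * min (γA * Fintype.card A) (γB * Fintype.card B) →
        D.Corrects (fun x => expanderHX H *ᵥ x) (rowSpace (expanderHZ H) : Set _) e

/-- **Fawzi–Grospellier–Leverrier 2018, Proposition 11** (adversarial radius of the `β`-version),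
`X`-sector: for a `(d_A, d_B)`-biregular `(γ_A, δ_A, γ_B, δ_B)`-left-right-expanding `G`, with
`r = d_A/d_B` and `β = β₀` (Def. 10), "the small-set-flip decoding algorithm of parameter `β` … can
correct any adversarial error of size up to `t_SSF(β)` where `t_SSF(β) ≥ (rβ/(1+β)) min(γ_A n_A, γ_B n_B)`",
"for any non-deterministic choice of the `Fᵢ`" — i.e. every small-set-flip decoder with threshold
`κ = β₀ Δ_B` corrects every error of weight `≤ (rβ₀/(1+β₀)) min(γ_A n_A, γ_B n_B)`. (Vacuous unless
`β₀ > 0`, "`δ_A, δ_B < 1/8` is sufficient".) STATEMENT ONLY.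
[cite: FawziGrospellierLeverrier2018, Prop 11 with Def 10 (§3.2; proof App. B)] -/
def FGL18_proposition11 : Prop :=
  ∀ (A B : Type) [Fintype A] [Fintype B] [DecidableEq A] [DecidableEq B]
    (H : Matrix B A (ZMod 2)) (dA dB : ℕ) (γA δA γB δB : ℝ),
    IsBiregular H dA dB → IsLeftRightExpanding H dA dB γA δA γB δB →
    0 < dA → 0 < dB → 0 < γA → 0 < δA → 0 < γB → 0 < δB → 0 < betaZero dA dB δA δB →
    ∀ D : Decoder (A × B → ZMod 2) ((A × A) ⊕ (B × B) → ZMod 2),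
      IsSSFDecoder (betaZero dA dB δA δB * dB) (expanderHX H) (expanderHZ H) D →
      ∀ e : (A × A) ⊕ (B × B) → ZMod 2,
        (hammingNorm e : ℝ) ≤
            ((dA : ℝ) / dB) * betaZero dA dB δA δB / (1 + betaZero dA dB δA δB) *
              min (γA * Fintype.card A) (γB * Fintype.card B) →
        D.Corrects (fun x => expanderHX H *ᵥ x) (rowSpace (expanderHZ H) : Set _) e

open Classical in
/-- **Fawzi–Grospellier–Leverrier 2018, Theorem 1 — the threshold of the small-set-flip decoder
under local stochastic noise**, `X`-sector: "Consider a quantum expander code with sufficient expansion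
and the small-set-flip decoding algorithm (Algorithm 1). Then there exists a probability `p₀ > 0` and
constants `C, C'` such that if the noise parameter satisfies `p < p₀`, the small-set-flip decoding
algorithm corrects a random error with probability at least `1 - Cn(p/p₀)^{C'√n}`", "in the independent
error model, and also in the local stochastic error model". Typed: for fixed degrees `d_A, d_B` and
expansion parameters with `β₀ > 0` (the proof's "Under the condition that the expansion of the initial
graph `G` is good enough, the parameter `β = β₀ … is positive"), there are `p₀ > 0`, `C`, `C' > 0` such
that for EVERY biregular expanding `G` with these parameters (any sizes `n_A, n_B`, `n = n_A² + n_B²`),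
every small-set-flip decoder `D` (`κ = 0`) and every locally stochastic weight `μ` of parameter
`0 ≤ p < p₀` on the qubits (the tree's `IsLocallyStochastic`; the independent model is
`bernoulliWeight p`), the total weight of the errors that `D` does not correct is at most
`C n (p/p₀)^{C'√n}`. (The proof gives `p₀ = p_ls` of Thm 17 for `α = β₀/(1+β₀)` and the degree bound
`d = d_B² + 2d_B(d_A-1)` of the adjacency graph; the `Z`-sector is the statement for `Hᵀ`.) STATEMENT
ONLY — the Q5 "qLDPC + small-set-flip" threshold fact.
[cite: FawziGrospellierLeverrier2018, Thm 1 (§1, arXiv v2 p0004) and its proof (end of §4, p0014)] -/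
def FGL18_theorem1 : Prop :=
  ∀ (dA dB : ℕ) (γA δA γB δB : ℝ), 0 < dA → 0 < dB → 0 < γA → 0 < δA → 0 < γB → 0 < δB →
    0 < betaZero dA dB δA δB →
    ∃ (p₀ C C' : ℝ), 0 < p₀ ∧ 0 < C' ∧
      ∀ (A B : Type) [Fintype A] [Fintype B] [DecidableEq A] [DecidableEq B]
        (H : Matrix B A (ZMod 2)),
        IsBiregular H dA dB → IsLeftRightExpanding H dA dB γA δA γB δB →
        ∀ D : Decoder (A × B → ZMod 2) ((A × A) ⊕ (B × B) → ZMod 2),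
          IsSSFDecoder 0 (expanderHX H) (expanderHZ H) D →
          ∀ (p : ℝ) (μ : Finset ((A × A) ⊕ (B × B)) → ℝ), 0 ≤ p → p < p₀ →
            IsLocallyStochastic μ p →
            (∑ E ∈ univ.filter (fun E : Finset ((A × A) ⊕ (B × B)) =>
                ¬ D.Corrects (fun x => expanderHX H *ᵥ x) (rowSpace (expanderHZ H) : Set _)
                  (flipVec E)), μ E) ≤
              C * ((Fintype.card A : ℝ) ^ 2 + (Fintype.card B : ℝ) ^ 2) *
                (p / p₀) ^ (C' * Real.sqrt ((Fintype.card A : ℝ) ^ 2 + (Fintype.card B : ℝ) ^ 2))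

open Classical in
/-- **Fawzi–Grospellier–Leverrier 2018, Theorem 17 (`α`-percolation)**, local stochastic case: for a
graph `𝒢 = (V, ℰ)` with degree bounded by `d` (`d ≥ 3` so that the printed constant is defined),
`α ∈ (0,1]`, an integer `t ≥ 1`, and a locally stochastic error `E` of parameter `p < p_ls`
(`percolationValue d α`): `P[MaxConn_α(E) ≥ t] ≤ C|V|(p/p_ls)^{αt}` with
`1/C = (1 - 2^{h(α)/α} p)(1 - (p/p_ls)^α)`, `2^{h(α)/α} = e^{binEntropy α/α}`. (The i.i.d.
refinement eq. (probiid) is not typed.) Generic graph theory — the percolation input of Thm 1.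
STATEMENT ONLY. [cite: FawziGrospellierLeverrier2018, Thm 17 eqs. (pls), (problc) (§4, p0013)] -/
def FGL18_theorem17 : Prop :=
  ∀ (V : Type) [Fintype V] [DecidableEq V] (G : SimpleGraph V) [DecidableRel G.Adj] (d : ℕ),
    3 ≤ d → (∀ v : V, G.degree v ≤ d) →
    ∀ (α : ℝ), 0 < α → α ≤ 1 → ∀ (t : ℕ), 1 ≤ t →
    ∀ (p : ℝ) (μ : Finset V → ℝ), 0 < p → p < percolationValue d α → IsLocallyStochastic μ p →
      (∑ E ∈ univ.filter (fun E : Finset V => HasAlphaCluster G α t E), μ E) ≤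
        (1 / ((1 - Real.exp (Real.binEntropy α / α) * p) *
            (1 - (p / percolationValue d α) ^ α))) *
          Fintype.card V * (p / percolationValue d α) ^ (α * t)

end Facts

/-! ### Non-vacuity (appended 2026-08-27, qec-type-09): complete runs and small-set-flip decoders EXIST

So that the named facts above cannot be discharged vacuously: from every syndrome the procedure has a
complete valid run (each step lowers the syndrome weight by at least one; a ratio-maximising small set
exists whenever the while-condition holds, since `𝓕` is finite), hence a `Decoder` selecting one
complete run per syndrome exists for every threshold `κ`. PROVED (kernel axioms). -/

section Existence

variable {Q C R : Type*} [Fintype Q] [Fintype C] [Fintype R] [DecidableEq Q]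

/-- Small sets are nonempty (`𝓕` excludes `∅`: the ratio `decrease/|F|` is over `|F| ≥ 1`).
[cite: FawziGrospellierLeverrier2018, §2.3 (𝓕)] -/
theorem card_pos_of_mem_smallSets {Hg : Matrix R Q (ZMod 2)} {F : Finset Q}
    (hF : F ∈ smallSets Hg) : 0 < F.card := by
  rw [smallSets, Finset.mem_erase] at hF
  exact Finset.card_pos.2 (Finset.nonempty_iff_ne_empty.2 hF.1)

/-- If the while-condition holds at `σ` (the decoder does not halt), a valid step exists: any small set
maximising the ratio `decrease/|F|` ("`Fᵢ = argmax …`; pick an arbitrary one").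
[cite: FawziGrospellierLeverrier2018, Algorithms 1–2 (§2.3, §3.2)] -/
theorem exists_isSSFStep_of_not_halts {κ : ℝ} {Hs : Matrix C Q (ZMod 2)} {Hg : Matrix R Q (ZMod 2)}
    {σ : C → ZMod 2} (h : ¬ SSFHalts κ Hs Hg σ) : ∃ F, IsSSFStep κ Hs Hg σ F := by
  simp only [SSFHalts, not_forall, not_not, exists_prop] at h
  obtain ⟨F₀, hF₀, hpos₀, hκ₀⟩ := h
  obtain ⟨F, hF, hmax⟩ := Finset.exists_max_image (smallSets Hg)
    (fun F => (syndromeDecrease Hs σ F : ℝ) / F.card) ⟨F₀, hF₀⟩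
  have hc₀ : (0 : ℝ) < F₀.card := by exact_mod_cast card_pos_of_mem_smallSets hF₀
  have hc : (0 : ℝ) < F.card := by exact_mod_cast card_pos_of_mem_smallSets hF
  have hFF₀ : (syndromeDecrease Hs σ F₀ : ℝ) / F₀.card ≤ (syndromeDecrease Hs σ F : ℝ) / F.card :=
    hmax F₀ hF₀
  have hratio₀ : κ ≤ (syndromeDecrease Hs σ F₀ : ℝ) / F₀.card := by
    rw [le_div_iff₀ hc₀]; exact hκ₀
  have hpos₀' : (0 : ℝ) < syndromeDecrease Hs σ F₀ := by exact_mod_cast hpos₀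
  refine ⟨F, hF, ?_, ?_, hmax⟩
  · have h1 : 0 < (syndromeDecrease Hs σ F : ℝ) / F.card :=
      lt_of_lt_of_le (div_pos hpos₀' hc₀) hFF₀
    have h2 : (0 : ℝ) < syndromeDecrease Hs σ F := by
      by_contra hneg
      push Not at hneg
      have : (syndromeDecrease Hs σ F : ℝ) / F.card ≤ 0 := div_nonpos_of_nonpos_of_nonneg hneg hc.le
      linarith
    exact_mod_cast h2
  · have : κ ≤ (syndromeDecrease Hs σ F : ℝ) / F.card := hratio₀.trans hFF₀
    rwa [le_div_iff₀ hc] at this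

/-- **A complete valid run exists from every syndrome** (termination: every step lowers the syndrome
weight `|σᵢ|` by a positive integer). [cite: FawziGrospellierLeverrier2018, Algorithm 1 (|σᵢ| strictly decreases)] -/
theorem exists_isSSFRun (κ : ℝ) (Hs : Matrix C Q (ZMod 2)) (Hg : Matrix R Q (ZMod 2))
    (σ : C → ZMod 2) : ∃ l : List (Finset Q), IsSSFRun κ Hs Hg σ l := by
  suffices h : ∀ n : ℕ, ∀ σ : C → ZMod 2, hammingNorm σ ≤ n → ∃ l, IsSSFRun κ Hs Hg σ l from
    h _ σ le_rfl
  intro n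
  induction n with
  | zero =>
    intro σ hσ
    by_cases hh : SSFHalts κ Hs Hg σ
    · exact ⟨[], IsSSFRun.halt hh⟩
    · obtain ⟨F, hF⟩ := exists_isSSFStep_of_not_halts hh
      have hdec := hF.2.1
      simp only [syndromeDecrease] at hdec
      omega
  | succ n ih =>
    intro σ hσ
    by_cases hh : SSFHalts κ Hs Hg σ
    · exact ⟨[], IsSSFRun.halt hh⟩
    · obtain ⟨F, hF⟩ := exists_isSSFStep_of_not_halts hh
      have hdec := hF.2.1
      simp only [syndromeDecrease] at hdec
      obtain ⟨l, hl⟩ := ih (σ + Hs *ᵥ flipVec F) (by omega)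
      exact ⟨F :: l, IsSSFRun.step hF hl⟩

/-- **Small-set-flip decoders exist** for every threshold `κ` and every pair of matrices: select one
complete run per syndrome ("pick an arbitrary one if there are several choices"). Hence the named
facts `LTZ15_theorem2`, `FGL18_proposition11`, `FGL18_theorem1` quantify over a NONEMPTY class of
decoders. [cite: FawziGrospellierLeverrier2018, §3.2 (after Prop. 11: any non-deterministic choice of the Fᵢ)] -/
theorem exists_isSSFDecoder (κ : ℝ) (Hs : Matrix C Q (ZMod 2)) (Hg : Matrix R Q (ZMod 2)) :
    ∃ D : Decoder (C → ZMod 2) (Q → ZMod 2), IsSSFDecoder κ Hs Hg D :=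
  ⟨fun σ => runOutput (Classical.choose (exists_isSSFRun κ Hs Hg σ)),
    fun σ => ⟨_, Classical.choose_spec (exists_isSSFRun κ Hs Hg σ), rfl⟩⟩

end Existence

/-! ### Appended 2026-08-27 (qec-type-04 g3; qec-lead g3 ruling 02:12:59Z (3)): Theorem 2 with the
degree side condition

`LTZ15_theorem2` above is refutable AS TYPED — `not_LTZ15_theorem2` in
`QuantumExpanderCodesDegenerate.lean`: the edgeless graph `H = 0` (`Δ_A = Δ_B = 0`) satisfies every
hypothesis vacuously (`(1-δ)·0·|S| ≤ |Γ(S)|`), its `Q_G` has `H_X = H_Z = 0`, and no decoder corrects both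
`e = 0` and a single-qubit error although both have weight `< w₀`. The repaired statement below inserts
the source's standing assumption that `G` is a biregular GRAPH, i.e. `Δ_A, Δ_B ≥ 1` (LTZ15 §2: "a
biregular bipartite graph with left (resp. right) degree equal to `Δ_A` (resp. `Δ_B`)"), written
`0 < dA → 0 < dB →` exactly as in `FGL18_proposition11` / `FGL18_theorem1`. Nothing else is changed;
the "letting `n_A, n_B` grow" question recorded in the docstring of `LTZ15_theorem2` is untouched. -/

section FactsRepaired

/-- **Leverrier–Tillich–Zémor 2015, Theorem 2** (= FGL18 Thm 6), correction clause, `X`-sector, WITH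
the side condition `0 < d_A`, `0 < d_B` implicit in §2 (bi-regular graphs of positive degree; the
statement `LTZ15_theorem2` above omits it and is refuted by `H = 0`, see `not_LTZ15_theorem2` in
`QuantumExpanderCodesDegenerate.lean`): for a `(Δ_A, Δ_B)`-biregular (`Δ_A, Δ_B ≥ 1`)
`(γ_A, δ_A, γ_B, δ_B)`-left-right-expanding `G` with `δ_A, δ_B < 1/6`, every small-set-flip decoder
(Algorithm 1, `κ = 0`; any tie-breaking) "decodes any quantum error pattern of weight less than
`w₀ = (1/(3(1+Δ_B))) min(γ_A n_A, γ_B n_B)`" — typed for the errors `(e_X, 0)` (the `Z`-sector is the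
same statement for `Hᵀ`). NOT typed: "runs in time linear in the code length". -- TODO(general form):
as for `LTZ15_theorem2`, the printed clause "Letting `Δ_A` and `Δ_B` be fixed and allowing `n_A, n_B` to
grow" is read as qualifying the running-time claim only. STATEMENT ONLY.
[cite: LeverrierTillichZemor2015, Thm 2 eq. (w0) (arXiv v1 p0006) and §2 (biregular graph, p0005), §3 (p0007)] [cite: FawziGrospellierLeverrier2018, Thm 6] -/
def LTZ15_theorem2_pos : Prop :=
  ∀ (A B : Type) [Fintype A] [Fintype B] [DecidableEq A] [DecidableEq B]
    (H : Matrix B A (ZMod 2)) (dA dB : ℕ) (γA δA γB δB : ℝ),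
    IsBiregular H dA dB → IsLeftRightExpanding H dA dB γA δA γB δB →
    0 < dA → 0 < dB → 0 < γA → 0 < δA → δA < 1 / 6 → 0 < γB → 0 < δB → δB < 1 / 6 →
    ∀ D : Decoder (A × B → ZMod 2) ((A × A) ⊕ (B × B) → ZMod 2),
      IsSSFDecoder 0 (expanderHX H) (expanderHZ H) D →
      ∀ e : (A × A) ⊕ (B × B) → ZMod 2,
        (hammingNorm e : ℝ) <
            1 / (3 * (1 + (dB : ℝ))) * min (γA * Fintype.card A) (γB * Fintype.card B) →
        D.Corrects (fun x => expanderHX H *ᵥ x) (rowSpace (expanderHZ H) : Set _) e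

/-- The repaired fact is a WEAKENING of the statement as first typed (it only adds hypotheses); recorded so
that any use of `LTZ15_theorem2` can be ported mechanically. PROVED (trivial).
[cite: LeverrierTillichZemor2015, Thm 2 (arXiv v1 p0006)] -/
theorem LTZ15_theorem2_pos_of_LTZ15_theorem2 (h : LTZ15_theorem2) : LTZ15_theorem2_pos := by
  intro A B _ _ _ _ H dA dB γA δA γB δB hreg hexp _ _ hγA hδA hδA' hγB hδB hδB' D hD e he
  exact h A B H dA dB γA δA γB δB hreg hexp hγA hδA hδA' hγB hδB hδB' D hD e he

end FactsRepaired

/-! ### Appended 2026-08-27 (qec-type-04 g3; qec-lead g3 block 7 (1)(ii), writer's consent qec-type-09 g3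
02:52:42Z): Proposition 11 with the source's convention `d_A ≤ d_B`

`FGL18_proposition11` above is refutable AS TYPED — `not_FGL18_proposition11` in
`QuantumExpanderCodesDegenerate.lean`: the `(2,1)`-biregular star forest (`d_A = 2 > d_B = 1`) meets every
typed hypothesis while two weight-one errors inside the radius share a syndrome and differ by a logical
operator. The printed proof (FGL18 §7.1, arXiv v2 p0018) uses the "reduced cardinality" inequality
`d_A ‖E‖ ≤ |E| ≤ d_B ‖E‖`, valid exactly when `d_A ≤ d_B` — the paper's standing convention (App. A's
example has `d_A = 38 < d_B = 39`; the sentence "`n_A < n_B`" of §2.3, p0008, is inconsistent with it and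
with biregularity `n_A d_A = n_B d_B`, and is read as a misprint for `n_A ≥ n_B`). The repaired statement
below adds `dA ≤ dB` and nothing else. -/

section FactsRepaired2

/-- **Fawzi–Grospellier–Leverrier 2018, Proposition 11** (adversarial radius of the `β`-version),
`X`-sector, WITH the source's convention `d_A ≤ d_B` (FGL18 §7.1 eq. `d_A‖E‖ ≤ |E| ≤ d_B‖E‖`, p0018;
App. A example `d_A = 38 < d_B = 39`; the statement `FGL18_proposition11` above omits it and is refuted
by the `(2,1)` star forest, see `not_FGL18_proposition11`): for a `(d_A, d_B)`-biregular, `d_A ≤ d_B`,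
`(γ_A, δ_A, γ_B, δ_B)`-left-right-expanding `G`, with `r = d_A/d_B` and `β = β₀` (Def. 10), "the
small-set-flip decoding algorithm of parameter `β` … can correct any adversarial error of size up to
`t_SSF(β)` where `t_SSF(β) ≥ (rβ/(1+β)) min(γ_A n_A, γ_B n_B)`", "for any non-deterministic choice of
the `Fᵢ`" — i.e. every small-set-flip decoder with threshold `κ = β₀ Δ_B` corrects every error of weight
`≤ (rβ₀/(1+β₀)) min(γ_A n_A, γ_B n_B)`. (Vacuous unless `β₀ > 0`, "`δ_A, δ_B < 1/8` is sufficient".)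
STATEMENT ONLY. [cite: FawziGrospellierLeverrier2018, Prop 11 with Def 10 (§3.2, arXiv v2 p0011); proof App. B = §7.1 (p0018-p0019)] -/
def FGL18_proposition11_le : Prop :=
  ∀ (A B : Type) [Fintype A] [Fintype B] [DecidableEq A] [DecidableEq B]
    (H : Matrix B A (ZMod 2)) (dA dB : ℕ) (γA δA γB δB : ℝ),
    IsBiregular H dA dB → IsLeftRightExpanding H dA dB γA δA γB δB →
    0 < dA → 0 < dB → dA ≤ dB → 0 < γA → 0 < δA → 0 < γB → 0 < δB → 0 < betaZero dA dB δA δB →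
    ∀ D : Decoder (A × B → ZMod 2) ((A × A) ⊕ (B × B) → ZMod 2),
      IsSSFDecoder (betaZero dA dB δA δB * dB) (expanderHX H) (expanderHZ H) D →
      ∀ e : (A × A) ⊕ (B × B) → ZMod 2,
        (hammingNorm e : ℝ) ≤
            ((dA : ℝ) / dB) * betaZero dA dB δA δB / (1 + betaZero dA dB δA δB) *
              min (γA * Fintype.card A) (γB * Fintype.card B) →
        D.Corrects (fun x => expanderHX H *ᵥ x) (rowSpace (expanderHZ H) : Set _) e

/-- The repaired fact is a WEAKENING of the statement as first typed (one extra hypothesis); recorded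
so that any use of `FGL18_proposition11` can be ported mechanically. PROVED (trivial).
[cite: FawziGrospellierLeverrier2018, Prop 11 (§3.2, arXiv v2 p0011)] -/
theorem FGL18_proposition11_le_of_FGL18_proposition11 (h : FGL18_proposition11) :
    FGL18_proposition11_le := by
  intro A B _ _ _ _ H dA dB γA δA γB δB hreg hexp hdA hdB _ hγA hδA hγB hδB hβ D hD e he
  exact h A B H dA dB γA δA γB δB hreg hexp hdA hdB hγA hδA hγB hδB hβ D hD e he

end FactsRepaired2

/-! ### Appended 2026-08-27 (qec-type-04 g3; qec-lead g3 block 11 (4), writer's advance consent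
qec-type-09 g3 03:09:58Z): the standing convention `Δ_A ≤ Δ_B` of LTZ15 §2 in Theorem 2 and in FGL18
Theorem 1

LTZ15 §2 (arXiv v1 p0005 L3-5): "Let `|A| = n_A`, `|B| = n_B`, and suppose `n_B ≤ n_A`, so that
`Δ_A ≤ Δ_B`." The convention is USED in the proof of Theorem 2 (Lemma 10, p0009: "the syndrome `σ_X(e)`
has weight at most `Δ_B|e|`", i.e. the column weight `max(Δ_A, Δ_B)` of `H_X` is `Δ_B`), so
`LTZ15_theorem2_pos` above — which omits it — is still stronger than printed when `Δ_A > Δ_B` (no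
witness is known: class "faithfulness", not "refuted"); FGL18 Theorem 1 inherits the same convention
through Proposition 11 (`FGL18_proposition11_le`). The two definitions below add `dA ≤ dB` and nothing
else; the weakening lemmas port any use of the earlier names. -/

section FactsRepaired3

/-- **Leverrier–Tillich–Zémor 2015, Theorem 2**, correction clause, `X`-sector, with BOTH standing
hypotheses of §2 made explicit: positive degrees `0 < Δ_A`, `0 < Δ_B` (cf. `LTZ15_theorem2_pos`,
`not_LTZ15_theorem2`) AND the convention "`n_B ≤ n_A`, so that `Δ_A ≤ Δ_B`" (§2, arXiv v1 p0005 L5; used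
in Lemma 10, p0009, for `|σ_X(e)| ≤ Δ_B|e|`). Otherwise verbatim as `LTZ15_theorem2`: every small-set-flip
decoder (`κ = 0`) corrects every error of weight `< w₀ = (1/(3(1+Δ_B))) min(γ_A n_A, γ_B n_B)` when
`δ_A, δ_B < 1/6`. STATEMENT ONLY.
[cite: LeverrierTillichZemor2015, Thm 2 eq. (w0) (arXiv v1 p0006) with §2 conventions (p0005 L3-5)] [cite: FawziGrospellierLeverrier2018, Thm 6] -/
def LTZ15_theorem2_le : Prop :=
  ∀ (A B : Type) [Fintype A] [Fintype B] [DecidableEq A] [DecidableEq B]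
    (H : Matrix B A (ZMod 2)) (dA dB : ℕ) (γA δA γB δB : ℝ),
    IsBiregular H dA dB → IsLeftRightExpanding H dA dB γA δA γB δB →
    0 < dA → 0 < dB → dA ≤ dB → 0 < γA → 0 < δA → δA < 1 / 6 → 0 < γB → 0 < δB → δB < 1 / 6 →
    ∀ D : Decoder (A × B → ZMod 2) ((A × A) ⊕ (B × B) → ZMod 2),
      IsSSFDecoder 0 (expanderHX H) (expanderHZ H) D →
      ∀ e : (A × A) ⊕ (B × B) → ZMod 2,
        (hammingNorm e : ℝ) <
            1 / (3 * (1 + (dB : ℝ))) * min (γA * Fintype.card A) (γB * Fintype.card B) →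
        D.Corrects (fun x => expanderHX H *ᵥ x) (rowSpace (expanderHZ H) : Set _) e

/-- `LTZ15_theorem2_pos → LTZ15_theorem2_le` (one extra hypothesis). PROVED (trivial).
[cite: LeverrierTillichZemor2015, Thm 2 (arXiv v1 p0006)] -/
theorem LTZ15_theorem2_le_of_LTZ15_theorem2_pos (h : LTZ15_theorem2_pos) : LTZ15_theorem2_le := by
  intro A B _ _ _ _ H dA dB γA δA γB δB hreg hexp hdA hdB _ hγA hδA hδA' hγB hδB hδB' D hD e he
  exact h A B H dA dB γA δA γB δB hreg hexp hdA hdB hγA hδA hδA' hγB hδB hδB' D hD e he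

open Classical in
/-- **Fawzi–Grospellier–Leverrier 2018, Theorem 1** (threshold of the small-set-flip decoder under local
stochastic noise, `X`-sector) with the convention `d_A ≤ d_B` that its proof inherits from Prop. 11
(§7.1 eq. `d_A‖E‖ ≤ |E| ≤ d_B‖E‖`, arXiv v2 p0018; App. A example `d_A = 38 < d_B = 39`) made explicit;
otherwise verbatim as `FGL18_theorem1` above (which omits it: stronger than printed for `d_A > d_B`, no
witness known). STATEMENT ONLY.
[cite: FawziGrospellierLeverrier2018, Thm 1 (§1, arXiv v2 p0004) and its proof (end of §4, p0014) via Prop 11] -/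
def FGL18_theorem1_le : Prop :=
  ∀ (dA dB : ℕ) (γA δA γB δB : ℝ), 0 < dA → 0 < dB → dA ≤ dB → 0 < γA → 0 < δA → 0 < γB → 0 < δB →
    0 < betaZero dA dB δA δB →
    ∃ (p₀ C C' : ℝ), 0 < p₀ ∧ 0 < C' ∧
      ∀ (A B : Type) [Fintype A] [Fintype B] [DecidableEq A] [DecidableEq B]
        (H : Matrix B A (ZMod 2)),
        IsBiregular H dA dB → IsLeftRightExpanding H dA dB γA δA γB δB →
        ∀ D : Decoder (A × B → ZMod 2) ((A × A) ⊕ (B × B) → ZMod 2),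
          IsSSFDecoder 0 (expanderHX H) (expanderHZ H) D →
          ∀ (p : ℝ) (μ : Finset ((A × A) ⊕ (B × B)) → ℝ), 0 ≤ p → p < p₀ →
            IsLocallyStochastic μ p →
            (∑ E ∈ univ.filter (fun E : Finset ((A × A) ⊕ (B × B)) =>
                ¬ D.Corrects (fun x => expanderHX H *ᵥ x) (rowSpace (expanderHZ H) : Set _)
                  (flipVec E)), μ E) ≤
              C * ((Fintype.card A : ℝ) ^ 2 + (Fintype.card B : ℝ) ^ 2) *
                (p / p₀) ^ (C' * Real.sqrt ((Fintype.card A : ℝ) ^ 2 + (Fintype.card B : ℝ) ^ 2))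

open Classical in
/-- `FGL18_theorem1 → FGL18_theorem1_le` (one extra hypothesis). PROVED (trivial).
[cite: FawziGrospellierLeverrier2018, Thm 1 (§1, arXiv v2 p0004)] -/
theorem FGL18_theorem1_le_of_FGL18_theorem1 (h : FGL18_theorem1) : FGL18_theorem1_le := by
  intro dA dB γA δA γB δB hdA hdB _ hγA hδA hγB hδB hβ
  exact h dA dB γA δA γB δB hdA hdB hγA hδA hγB hδB hβ

end FactsRepaired3

end Literature.InformationTheory.QuantumCodes
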